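/-
Origin: expansion seat `planner-pub-hodgecm-toy2-g2-0`, handover #3 2026-08-18T05:04:00Z (`HOME/pub-hodgecm-toy2-g2/lean/Toy2g2/StarObj.lean`, md5 4fd5494f, 246 lines);
landed by the gen-6 packager in gate run 22 as `HodgeCM/Model/Toy/StarObj.lean` (import ^import Toy2g2\.Star(Top|Dual|Obj|Hodge|AlgDuality)\b→import HodgeCM.Model.Toy.Star\1 ×1).
-/
/-
Copyright: pub-hodgecm formalisation cell (harness21, 2026). New file (not vendored).
Origin: HOME/pub-hodgecm-toy2-g2/lean/Toy2g2/StarObj.lean (WIP module `Toy2g2.StarObj`; intended final place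
`HodgeCM/Model/Toy/StarObj.lean` = module `HodgeCM.Model.Toy.StarObj`, CONTRIBUTING §3 L5) (seat
planner-pub-hodgecm-toy2-g2-0, consistency seat 2 gen 2, towards M28 `Fact_algDuality` in the toy universe).
-/
import Summits.HodgeConjecture.HodgeCM.Model.Toy.StarDual
import Summits.HodgeConjecture.HodgeCM.Model.Toy.EigenBasis_2

/-!
# Conjugation data and the twisted trace form of a toy object

For a toy object `X` (a product of CM atoms `Lᵢ ⊂ ℂ`) a `ConjData` is a choice, for every atom, of a ring endomorphism
`cᵢ : Lᵢ → Lᵢ` inducing complex conjugation under every complex embedding.  The **twisted trace form**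

  `b(x, y) = Σᵢ Tr_{Lᵢ/ℚ} (xᵢ · cᵢ(yᵢ))`

is a nondegenerate bilinear form on `L X = Πᵢ Lᵢ` for which multiplication by `a` is adjoint to multiplication by
`c(a)` (`form_mulLeft`).  Over `ℂ` it pairs the eigenline `ℂ e_s` only with the conjugate eigenline `ℂ e_{s̄}`
(`formC_eB_eq_zero`).  We also record the holomorphic-index counts of complements and conjugates of index sets
(`two_mul_nhol_compl_barC`), used for the Hodge property of the star operator in `Toy2g2.StarHodge`.
-/

noncomputable section

open scoped TensorProduct

namespace HodgeCM.Toy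

namespace Obj

open exteriorPower Module Set Set.powersetCard

variable (X : Obj)

/-- conjugation data on a toy object -/
structure ConjData where
  /-- a ring endomorphism of each atom's field … -/
  c : ∀ i : X.s.toType, (X.atom i).F →+* (X.atom i).F
  /-- … which is complex conjugation under every complex embedding -/
  emb_c : ∀ (i : X.s.toType) (τ : (X.atom i).F →+* ℂ) (x : (X.atom i).F), τ (c i x) = starRingEnd ℂ (τ x)

namespace ConjData

variable {X} (C : X.ConjData)

/-- (Ported verbatim from the HodgeCMPerL package; no docstring in the source.) -/
lemma c_c (i : X.s.toType) (x : (X.atom i).F) : C.c i (C.c i x) = x := by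
  apply (algebraMap ((X.atom i).F) ℂ).injective
  rw [C.emb_c, C.emb_c, starRingEnd_self_apply]

/-- conjugation on `L X`, componentwise -/
def cL : X.L →+* X.L := RingHom.pi fun i => (C.c i).comp (Pi.evalRingHom _ i)

/-- (Ported verbatim from the HodgeCMPerL package; no docstring in the source.) -/
@[simp] lemma cL_apply (a : X.L) (i : X.s.toType) : C.cL a i = C.c i (a i) := rfl

/-- (Ported verbatim from the HodgeCMPerL package; no docstring in the source.) -/
lemma cL_cL (a : X.L) : C.cL (C.cL a) = a := by
  funext i
  simp [C.c_c]

/-- **the twisted trace form** `b(x, y) = Σᵢ Tr(xᵢ · cᵢ(yᵢ))` -/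
def form : LinearMap.BilinForm ℚ X.L :=
  ∑ i, (Algebra.traceForm ℚ (X.atom i).F).compl₁₂ (LinearMap.proj i)
    ((C.c i).toRatAlgHom.toLinearMap ∘ₗ LinearMap.proj i)

/-- (Ported verbatim from the HodgeCMPerL package; no docstring in the source.) -/
lemma form_apply (x y : X.L) : C.form x y = ∑ i, Algebra.trace ℚ _ (x i * C.c i (y i)) := by
  simp only [form, LinearMap.coe_sum, Finset.sum_apply, LinearMap.compl₁₂_apply, LinearMap.proj_apply,
    LinearMap.coe_comp, Function.comp_apply, AlgHom.toLinearMap_apply, RingHom.toRatAlgHom_apply,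
    Algebra.traceForm_apply]

/-- adjointness of the multiplications by `c(a)` and by `a` -/
lemma form_mulLeft (a u w : X.L) : C.form (C.cL a * u) w = C.form u (a * w) := by
  rw [form_apply, form_apply]
  refine Finset.sum_congr rfl fun i _ => ?_
  simp only [Pi.mul_apply, cL_apply, map_mul]
  congr 1
  ring

/-- (Ported verbatim from the HodgeCMPerL package; no docstring in the source.) -/
lemma form_mulLeft' (a u w : X.L) :
    C.form (LinearMap.mulLeft ℚ (C.cL a) u) w = C.form u (LinearMap.mulLeft ℚ a w) := by
  simp only [LinearMap.mulLeft_apply, form_mulLeft]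

/-- the twisted trace form is nondegenerate -/
theorem form_nondegenerate : C.form.Nondegenerate := by
  classical
  refine LinearMap.BilinForm.Nondegenerate.ofSeparatingLeft fun x hx => ?_
  funext i
  have key : ∀ z : (X.atom i).F, Algebra.traceForm ℚ _ (x i) z = 0 := by
    intro z
    have h := hx (Pi.single i (C.c i z))
    rw [form_apply, Finset.sum_eq_single i (fun j _ hji => by simp [Pi.single_eq_of_ne hji]) (by simp)] at h
    simpa [C.c_c, Algebra.traceForm_apply] using h
  exact (traceForm_nondegenerate ℚ (X.atom i).F).1 (x i) key

/-! ### Eigenvectors and the complexified form -/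

/-- `a ∈ L X` acts on the eigenvector `e_s` of `ℂ ⊗ L X` by the scalar `s.2 (a_{s.1})`. -/
lemma mulLeft_baseChange_eB (a : X.L) (s : X.Idx) :
    (LinearMap.mulLeft ℚ a).baseChange ℂ (X.eB s) = s.2 (a s.1) • X.eB s := by
  obtain ⟨i, τ⟩ := s
  rw [eB_apply, eT]
  have hcomm : LinearMap.mulLeft ℚ a ∘ₗ LinearMap.single ℚ (fun j => ((X.atom j).F : Type)) i
      = LinearMap.single ℚ (fun j => ((X.atom j).F : Type)) i ∘ₗ LinearMap.mulLeft ℚ (a i) := by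
    apply LinearMap.ext
    intro z
    simp only [LinearMap.coe_comp, Function.comp_apply, LinearMap.mulLeft_apply, LinearMap.coe_single]
    exact (Pi.single_mul_right (f := a) z).symm
  rw [← LinearMap.comp_apply, ← LinearMap.baseChange_comp, hcomm, LinearMap.baseChange_comp,
    LinearMap.comp_apply, baseChange_mulLeft, tmul_mul_eps, map_smul]

/-- the complexified twisted trace form on `ℂ ⊗ L X` -/
def formC : LinearMap.BilinForm ℂ X.LC := C.form.baseChange ℂ

/-- (Ported verbatim from the HodgeCMPerL package; no docstring in the source.) -/
lemma formC_tmul (z z' : ℂ) (m m' : X.L) : C.formC (z ⊗ₜ m) (z' ⊗ₜ m') = (C.form m m') • (z * z') :=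
  LinearMap.BilinForm.baseChange_tmul _ _ _ _ _

/-- base change of an adjointness relation -/
lemma formC_baseChange {f g : X.L →ₗ[ℚ] X.L} (h : ∀ u w, C.form (f u) w = C.form u (g w)) (x y : X.LC) :
    C.formC (f.baseChange ℂ x) y = C.formC x (g.baseChange ℂ y) := by
  induction x using TensorProduct.induction_on with
  | zero => simp
  | tmul z m =>
    induction y using TensorProduct.induction_on with
    | zero => simp
    | tmul z' m' => simp only [LinearMap.baseChange_tmul, formC_tmul, h]
    | add y₁ y₂ h₁ h₂ => simp only [map_add, h₁, h₂]
  | add x₁ x₂ h₁ h₂ => simp only [map_add, LinearMap.add_apply, h₁, h₂]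

/-- adjointness over `ℂ` -/
lemma formC_mulLeft (a : X.L) (x y : X.LC) :
    C.formC ((LinearMap.mulLeft ℚ (C.cL a)).baseChange ℂ x) y
      = C.formC x ((LinearMap.mulLeft ℚ a).baseChange ℂ y) :=
  C.formC_baseChange (fun u w => C.form_mulLeft' a u w) x y

/-- **The complexified form pairs `e_s` only with `e_{s̄}`.** -/
theorem formC_eB_eq_zero {s t : X.Idx} (hst : t ≠ X.bar s) : C.formC (X.eB s) (X.eB t) = 0 := by
  -- the eigen-relation `conj (s.2 (a_{s.1})) · b(e_s, e_t) = t.2 (a_{t.1}) · b(e_s, e_t)` for every `a`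
  have key : ∀ a : X.L, starRingEnd ℂ (s.2 (a s.1)) * C.formC (X.eB s) (X.eB t)
      = t.2 (a t.1) * C.formC (X.eB s) (X.eB t) := by
    intro a
    have h := C.formC_mulLeft a (X.eB s) (X.eB t)
    rw [mulLeft_baseChange_eB, mulLeft_baseChange_eB, map_smul, map_smul, LinearMap.smul_apply, smul_eq_mul,
      smul_eq_mul, cL_apply, C.emb_c] at h
    exact h
  obtain ⟨i, σ⟩ := s
  obtain ⟨j, τ⟩ := t
  by_contra hF
  by_cases hij : j = i
  · subst hij
    have hτ : τ ≠ NumberField.ComplexEmbedding.conjugate σ := fun h => hst (by subst h; rfl)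
    obtain ⟨z, hz⟩ : ∃ z, τ z ≠ NumberField.ComplexEmbedding.conjugate σ z := by
      by_contra h
      exact hτ (RingHom.ext fun z => not_not.mp fun hz => h ⟨z, hz⟩)
    have h := key (Pi.single j z)
    rw [Pi.single_eq_same] at h
    exact hz (mul_right_cancel₀ hF h).symm
  · have h := key (Pi.single j 1)
    rw [Pi.single_eq_same, Pi.single_eq_of_ne (Ne.symm hij), map_zero, map_zero, map_one, zero_mul, one_mul] at h
    exact hF h.symm

end ConjData

/-! ### Conjugates and complements of index sets -/

/-- complex conjugation of indices, as an embedding -/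
def barEmb : X.Idx ↪ X.Idx := ⟨X.bar, Function.Involutive.injective X.bar_bar⟩

/-- (Ported verbatim from the HodgeCMPerL package; no docstring in the source.) -/
@[simp] lemma barEmb_apply (s : X.Idx) : X.barEmb s = X.bar s := rfl

/-- complex conjugation of `k`-sets of indices -/
def barC {k : ℕ} (S : powersetCard X.Idx k) : powersetCard X.Idx k := powersetCard.map k X.barEmb S

/-- (Ported verbatim from the HodgeCMPerL package; no docstring in the source.) -/
@[simp] lemma val_barC {k : ℕ} (S : powersetCard X.Idx k) : (X.barC S).val = S.val.map X.barEmb := rfl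

/-- (Ported verbatim from the HodgeCMPerL package; no docstring in the source.) -/
lemma mem_barC {k : ℕ} (S : powersetCard X.Idx k) (s : X.Idx) : s ∈ X.barC S ↔ X.bar s ∈ S := by
  rw [← mem_coe_iff, val_barC, Finset.mem_map]
  constructor
  · rintro ⟨t, ht, rfl⟩
    rw [barEmb_apply, bar_bar]
    exact mem_coe_iff.mp ht
  · intro h
    exact ⟨X.bar s, mem_coe_iff.mpr h, X.bar_bar s⟩

/-- (Ported verbatim from the HodgeCMPerL package; no docstring in the source.) -/
@[simp] lemma barC_barC {k : ℕ} (S : powersetCard X.Idx k) : X.barC (X.barC S) = S := by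
  apply Subtype.ext
  ext s
  rw [mem_coe_iff, mem_barC, mem_barC, bar_bar, mem_coe_iff]

/-- (Ported verbatim from the HodgeCMPerL package; no docstring in the source.) -/
lemma nhol_eq (S : Finset X.Idx) [DecidablePred X.hol] : X.nhol S = (S.filter X.hol).card := by
  unfold nhol
  rw [Finset.filter_congr_decidable]

/-- `#hol(S̄) + #hol(S) = #S` -/
lemma nhol_bar_add (S : Finset X.Idx) : X.nhol (S.map X.barEmb) + X.nhol S = S.card := by
  classical
  rw [nhol_eq, nhol_eq, Finset.filter_map, Finset.card_map]
  have h1 : S.filter (X.hol ∘ X.barEmb) = S.filter (fun s => ¬ X.hol s) :=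
    Finset.filter_congr fun s _ => by simp [hol_bar_iff]
  rw [h1, add_comm, Finset.card_filter_add_card_filter_not]

/-- `#hol(T) + #hol(Tᶜ) = #hol(all)` -/
lemma nhol_add_nhol_compl (T : Finset X.Idx) : X.nhol T + X.nhol Tᶜ = X.nhol Finset.univ := by
  haveI : DecidablePred X.hol := Classical.decPred _
  rw [nhol_eq, nhol_eq, nhol_eq, ← Finset.card_union_of_disjoint, ← Finset.filter_union]
  · have hT : T ∪ Tᶜ = Finset.univ := by
      ext s
      simp only [Finset.mem_union, Finset.mem_compl, Finset.mem_univ, iff_true]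
      exact em _
    rw [hT]
  · exact Finset.disjoint_filter_filter (disjoint_compl_right : Disjoint T Tᶜ)

/-- half of all indices are holomorphic -/
lemma two_mul_nhol_univ : 2 * X.nhol Finset.univ = Fintype.card X.Idx := by
  classical
  rw [nhol_eq, two_mul]
  have h1 : (Finset.univ.filter X.hol).map X.barEmb = Finset.univ.filter (fun s => ¬ X.hol s) := by
    ext s
    simp only [Finset.mem_map, Finset.mem_filter, Finset.mem_univ, true_and, barEmb_apply]
    constructor
    · rintro ⟨t, ht, rfl⟩
      rwa [hol_bar_iff, not_not]
    · intro h
      exact ⟨X.bar s, (X.hol_bar_iff s).mpr h, X.bar_bar s⟩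
  nth_rw 1 [← Finset.card_map X.barEmb]
  rw [h1, add_comm, Finset.card_filter_add_card_filter_not, Finset.card_univ]

/-- the index set has `dim_ℚ L X` elements -/
lemma card_Idx : Fintype.card X.Idx = Module.finrank ℚ X.L := by
  rw [Fintype.card_sigma, Module.finrank_pi_fintype]
  exact Finset.sum_congr rfl fun i _ => NumberField.Embeddings.card ((X.atom i).F) ℂ

/-- **Counting**: for a `k`-set `S` and `T* = (S̄)ᶜ` one has `2·#hol(T*) + k = l + 2·#hol(S)`. -/
theorem two_mul_nhol_compl_barC {k l : ℕ} (hlk : l + k = Fintype.card X.Idx) (S : powersetCard X.Idx k) :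
    2 * X.nhol (compl hlk (X.barC S)).val + k = l + 2 * X.nhol S.val := by
  have h1 := X.nhol_bar_add S.val
  have h2 := X.nhol_add_nhol_compl (X.barC S).val
  have h3 := X.two_mul_nhol_univ
  rw [card_eq] at h1
  rw [val_barC] at h2
  rw [coe_compl, val_barC]
  omega

end Obj

end HodgeCM.Toy

end
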